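import Summits.NavierStokesRegularity.NavierStokesRegularity.Theorems.TypeILiouvilleTypeIliouvilleLWeakL3TailRecurrenceOfL3
import Summits.NavierStokesRegularity.NavierStokesRegularity.Theorems.TypeILiouvilleTypeIliouvilleLStubOseenL3ModConstPropagation
import HarnessLib

/-!
# The REGISTERED persistent stub S3ᵐ of crux `TypeIliouvilleL` (stmt-NavierStokesRegularity-10661)
# implies its weak-`L³` / vanishing-tail form S3ʷ: the two currencies are EQUIVALENT in kernel

Helper file (theorems only, no definition, no named fact, no `sorry`; lands
`--supports stmt-NavierStokesRegularity-10661`; LAND-ONLY, no skeleton touched). With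
`…WeakL3TailToRegisteredStub` (S3ʷ ⇒ registered S3ᵐ conclusion) this file gives the converse:
the registered conclusion of `stub_persistent_mild_backward_L3_recurrence` — `L³` recurrence to
constants `b_k` (possibly VARYING with `k`) along `τ_k → −∞` — implies the S3ʷ data (ONE constant,
uniform weak-`L³` bound, vanishing tail at one index):

* `const_eq_zero_of_memLp_volume` — a constant in `Lᵖ(ℝ³)`, `0 < p < ∞`, is `0`;
* `recurrenceConst_eq_of_persistentL3Recurrence` — the constants `b_k` of an `L³` recurrence of a
  member of print's class P all coincide (the tree's `stub_oseen_L3_modConst_propagation`: `L³`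
  modulo a constant propagates forward along bounded Oseen-mild solutions; two `L³` translates of one
  slice differ by an `L³` constant);
* `weakL3TailRecurrence_of_persistentL3Recurrence` — registered S3ᵐ conclusion for `v` ⇒ S3ʷ data
  for `v` (then Chebyshev + the `L³` tail, `weakL3TailRecurrence_of_L3Recurrence_oneConst`);
* `weakL3TailRecurrence_statement_of_stubS3m` — statement level: S3ᵐ ⇒ S3ʷ. Together with
  `stubS3m_statement_of_weakL3TailRecurrence`: **S3ᵐ ⟺ S3ʷ**, kernel-checked, without passing
  through (L).

Nothing here proves S3ᵐ, S3ʷ, (L), or anything about Navier–Stokes regularity.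
-/

set_option linter.dupNamespace false

namespace Summit.NavierStokesRegularity.NavierStokesRegularity.Theorems

open MeasureTheory Filter Set Function Metric
open scoped ENNReal NNReal Topology
open Literature.Analysis Literature.Analysis.FluidPDE

/-- A constant function on `ℝ³` lies in `Lᵖ` (`0 < p < ∞`) only if it is zero (Lebesgue measure
of `ℝ³` is infinite). [folklore] -/
theorem const_eq_zero_of_memLp_volume {F : Type*} [NormedAddCommGroup F] {c : F} {p : ℝ≥0∞}
    (hp0 : p ≠ 0) (hptop : p ≠ ∞)
    (h : MemLp (fun _ : EuclideanSpace ℝ (Fin 3) => c) p (volume : Measure (EuclideanSpace ℝ (Fin 3)))) :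
    c = 0 := by
  rcases (memLp_const_iff hp0 hptop).1 h with h0 | hfin
  · exact h0
  · exact absurd hfin (by simp)

/-- **The constants of an `L³` recurrence coincide.** Let `v` be in print's class P (continuous and
uniformly bounded on `(−∞,0) × ℝ³`, weakly divergence free, Oseen-mild) and let
`v(τ_k) − b_k ∈ L³` at negative times `τ_k`. Then `b_k = b_j` for all `k, j`: if `τ_k < τ_j`,
`v(τ_j) − b_k ∈ L³` by forward propagation of `L³` modulo a constant
(`stub_oseen_L3_modConst_propagation`), and `(v(τ_j) − b_k) − (v(τ_j) − b_j) = b_j − b_k` is an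
`L³` constant, hence `0`. [cite: LemarieRieusset2016, Thm 9.12 with (7.32)–(7.33)] -/
theorem recurrenceConst_eq_of_persistentL3Recurrence
    (v : ℝ → EuclideanSpace ℝ (Fin 3) → EuclideanSpace ℝ (Fin 3))
    (hvc : ContinuousOn (uncurry v) (Iio 0 ×ˢ univ))
    (hvK : ∃ K : ℝ, ∀ t < 0, ∀ x, ‖v t x‖ ≤ K)
    (hvd : ∀ t < 0, IsWeaklyDivFree (v t))
    (hvm : ∀ s t : ℝ, s < t → t < 0 → ∀ x,
      v t x = UnboundedOperators.heatExtension (v s) (t - s) x - oseenDuhamel 1 s v v t x)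
    {b : ℕ → EuclideanSpace ℝ (Fin 3)} {τ : ℕ → ℝ} (hτ0 : ∀ k, τ k < 0)
    (hmem : ∀ k, MemLp (fun x => v (τ k) x - b k) 3 (volume : Measure (EuclideanSpace ℝ (Fin 3)))) :
    ∀ k j, b k = b j := by
  -- two `L³` translates of one slice differ by an `L³` constant
  have key : ∀ (t : ℝ) (c c' : EuclideanSpace ℝ (Fin 3)),
      MemLp (fun x => v t x - c) 3 (volume : Measure (EuclideanSpace ℝ (Fin 3))) →
      MemLp (fun x => v t x - c') 3 (volume : Measure (EuclideanSpace ℝ (Fin 3))) → c = c' := by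
    intro t c c' hc hc'
    have hsub := hc'.sub hc
    have hfun : (fun x => v t x - c') - (fun x => v t x - c) =
        fun _ : EuclideanSpace ℝ (Fin 3) => c - c' := by
      funext x; simp only [Pi.sub_apply]; abel
    rw [hfun] at hsub
    exact (sub_eq_zero.1 (const_eq_zero_of_memLp_volume (by norm_num) (by norm_num) hsub))
  -- propagate the earlier constant to the later time
  have prop : ∀ k j, τ k < τ j → b k = b j := by
    intro k j hkj
    have h1 : MemLp (fun x => v (τ j) x - b k) 3 (volume : Measure (EuclideanSpace ℝ (Fin 3))) :=
      stub_oseen_L3_modConst_propagation v (b k) (τ k) (τ j) hkj (hτ0 j) hvc hvK hvd hvm (hmem k)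
    exact key (τ j) (b k) (b j) h1 (hmem j)
  intro k j
  rcases lt_trichotomy (τ k) (τ j) with h | h | h
  · exact prop k j h
  · have h1 : MemLp (fun x => v (τ j) x - b k) 3 (volume : Measure (EuclideanSpace ℝ (Fin 3))) := by
      rw [← h]; exact hmem k
    exact key (τ j) (b k) (b j) h1 (hmem j)
  · exact (prop j k h).symm

/-- **Registered S3ᵐ conclusion for `v` ⇒ S3ʷ data for `v`.** Let `v` be in print's class P. If
`‖v(τ_k) − b_k‖_{L³} ≤ M` along negative times `τ_k → −∞` (the conclusion of
`stub_persistent_mild_backward_L3_recurrence`, constants possibly varying), then there are ONE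
constant `b`, a finite `M'` and an index `k₀` with `s³·vol{s < ‖v(τ_k) − b‖} ≤ M'` for all `s > 0`,
`k`, and `s³·vol{s < ‖v(τ_{k₀}) − b‖} → 0` as `s → 0⁺` (the constants coincide by
`recurrenceConst_eq_of_persistentL3Recurrence`; then Chebyshev and the `L³` tail,
`weakL3TailRecurrence_of_L3Recurrence_oneConst`). [cite: LemarieRieusset2016, Thm 9.12 with (7.32)–(7.33)] -/
theorem weakL3TailRecurrence_of_persistentL3Recurrence
    (v : ℝ → EuclideanSpace ℝ (Fin 3) → EuclideanSpace ℝ (Fin 3))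
    (hvc : ContinuousOn (uncurry v) (Iio 0 ×ˢ univ))
    (hvK : ∃ K : ℝ, ∀ t < 0, ∀ x, ‖v t x‖ ≤ K)
    (hvd : ∀ t < 0, IsWeaklyDivFree (v t))
    (hvm : ∀ s t : ℝ, s < t → t < 0 → ∀ x,
      v t x = UnboundedOperators.heatExtension (v s) (t - s) x - oseenDuhamel 1 s v v t x)
    (hS3m : ∃ (b : ℕ → EuclideanSpace ℝ (Fin 3)) (τ : ℕ → ℝ) (M : NNReal),
      (∀ k, τ k < 0) ∧ Tendsto τ atTop atBot ∧
      ∀ k, eLpNorm (fun x => v (τ k) x - b k) 3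
        (volume : Measure (EuclideanSpace ℝ (Fin 3))) ≤ (M : ENNReal)) :
    ∃ (b : EuclideanSpace ℝ (Fin 3)) (τ : ℕ → ℝ) (M : ℝ≥0) (k₀ : ℕ),
      (∀ k, τ k < 0) ∧ Tendsto τ atTop atBot ∧
      (∀ (k : ℕ) (s : ℝ), 0 < s →
        ENNReal.ofReal s ^ 3 *
          (volume : Measure (EuclideanSpace ℝ (Fin 3))) {x | s < ‖v (τ k) x - b‖} ≤ (M : ℝ≥0∞)) ∧
      Tendsto (fun s : ℝ => ENNReal.ofReal s ^ 3 *
          (volume : Measure (EuclideanSpace ℝ (Fin 3))) {x | s < ‖v (τ k₀) x - b‖})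
        (𝓝[>] 0) (𝓝 0) := by
  obtain ⟨b, τ, M, hτ0, hτ, hL3⟩ := hS3m
  have hmeas : ∀ (k : ℕ) (c : EuclideanSpace ℝ (Fin 3)),
      AEStronglyMeasurable (fun x => v (τ k) x - c) (volume : Measure (EuclideanSpace ℝ (Fin 3))) := by
    intro k c
    have h1 : Continuous (v (τ k)) :=
      hvc.comp_continuous (continuous_const.prodMk continuous_id) fun y => ⟨hτ0 k, mem_univ y⟩
    exact (h1.sub continuous_const).aestronglyMeasurable
  have hmem : ∀ k, MemLp (fun x => v (τ k) x - b k) 3 (volume : Measure (EuclideanSpace ℝ (Fin 3))) :=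
    fun k => ⟨hmeas k (b k), (hL3 k).trans_lt ENNReal.coe_lt_top⟩
  have hconst := recurrenceConst_eq_of_persistentL3Recurrence v hvc hvK hvd hvm hτ0 hmem
  have hL3' : ∀ k, eLpNorm (fun x => v (τ k) x - b 0) 3
      (volume : Measure (EuclideanSpace ℝ (Fin 3))) ≤ (M : ℝ≥0∞) := fun k => by
    rw [← hconst k 0]; exact hL3 k
  obtain ⟨M', k₀, hwk, htail⟩ :=
    weakL3TailRecurrence_of_L3Recurrence_oneConst v (b 0) τ (fun k => hmeas k (b 0)) hL3'
  exact ⟨b 0, τ, M', k₀, hτ0, hτ, hwk, htail⟩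

/-- **Statement level: the registered stub S3ᵐ implies S3ʷ** (both over the persistent members of
print's class P). With `stubS3m_statement_of_weakL3TailRecurrence` (`…WeakL3TailToRegisteredStub`):
S3ᵐ ⟺ S3ʷ in kernel. [cite: LemarieRieusset2016, Thm 9.12 with (7.32)–(7.33)] -/
theorem weakL3TailRecurrence_statement_of_stubS3m
    (hS3m : ∀ v : ℝ → EuclideanSpace ℝ (Fin 3) → EuclideanSpace ℝ (Fin 3),
      ContinuousOn (uncurry v) (Iio 0 ×ˢ univ) →
      (∃ K : ℝ, ∀ t < 0, ∀ x, ‖v t x‖ ≤ K) →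
      (∀ t < 0, IsWeaklyDivFree (v t)) →
      (∀ s t : ℝ, s < t → t < 0 → ∀ x,
        v t x = UnboundedOperators.heatExtension (v s) (t - s) x - oseenDuhamel 1 s v v t x) →
      (¬ ∃ C : ℝ, ∀ t < 0, ∀ x, ‖v t x‖ ≤ C / Real.sqrt (-t)) →
      ∃ (b : ℕ → EuclideanSpace ℝ (Fin 3)) (τ : ℕ → ℝ) (M : NNReal),
        (∀ k, τ k < 0) ∧ Tendsto τ atTop atBot ∧
        ∀ k, eLpNorm (fun x => v (τ k) x - b k) 3
          (volume : Measure (EuclideanSpace ℝ (Fin 3))) ≤ (M : ENNReal)) :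
    ∀ v : ℝ → EuclideanSpace ℝ (Fin 3) → EuclideanSpace ℝ (Fin 3),
      ContinuousOn (uncurry v) (Iio 0 ×ˢ univ) →
      (∃ K : ℝ, ∀ t < 0, ∀ x, ‖v t x‖ ≤ K) →
      (∀ t < 0, IsWeaklyDivFree (v t)) →
      (∀ s t : ℝ, s < t → t < 0 → ∀ x,
        v t x = UnboundedOperators.heatExtension (v s) (t - s) x - oseenDuhamel 1 s v v t x) →
      (¬ ∃ C : ℝ, ∀ t < 0, ∀ x, ‖v t x‖ ≤ C / Real.sqrt (-t)) →
      ∃ (b : EuclideanSpace ℝ (Fin 3)) (τ : ℕ → ℝ) (M : ℝ≥0) (k₀ : ℕ),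
        (∀ k, τ k < 0) ∧ Tendsto τ atTop atBot ∧
        (∀ (k : ℕ) (s : ℝ), 0 < s →
          ENNReal.ofReal s ^ 3 *
            (volume : Measure (EuclideanSpace ℝ (Fin 3))) {x | s < ‖v (τ k) x - b‖} ≤ (M : ℝ≥0∞)) ∧
        Tendsto (fun s : ℝ => ENNReal.ofReal s ^ 3 *
            (volume : Measure (EuclideanSpace ℝ (Fin 3))) {x | s < ‖v (τ k₀) x - b‖})
          (𝓝[>] 0) (𝓝 0) :=
  fun v hvc hvK hvd hvm hpers =>
    weakL3TailRecurrence_of_persistentL3Recurrence v hvc hvK hvd hvm (hS3m v hvc hvK hvd hvm hpers)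

end Summit.NavierStokesRegularity.NavierStokesRegularity.Theorems
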